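import Literature.NumberTheory.Automorphic.HeckeIntegrandPureTensorOnBox
import Literature.NumberTheory.Automorphic.IdeleUnitBoxSplittingConstants
import Literature.NumberTheory.Automorphic.IdeleUnitBoxExhaustion
import HarnessLib

/-!
# The Euler factorisation of the unfolded global Hecke integral of a pure tensor cusp form of `GL₂`
# (Jacquet–Langlands (1970), (11.1.2), p. 171: `Ψ(s, φ) = ∏_v Ψ(s, W_v) = L_S(s, π) · ∏_{v ∈ S ∪ ∞} Ψ(s, W_v)`)

Topic `NumberTheory/Automorphic`; namespace `Literature.NumberTheory.Automorphic`. Theorems only (no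
definition, no named fact, no instance). The bookkeeping that turns

* the `S`-box identity `∫_{B(Sᶜ)} W_φ(diag(a,1)) |a|^s dν = c_S Λ₀(j(e_S)) Ψ_∞(s) ∏_{v ∈ S} Ψ_v(s)`
  (`setIntegral_ideleUnitBox_heckeIntegrand_pureTensor`, `HeckeIntegrandPureTensorOnBox`), valid for EVERY
  finite set `S' ⊇ S` of finite places,
* the compatibility of the constants `c_S = c_{S'} ∏_{v ∈ S' ∖ S} μ_v(𝒪_vˣ)`
  (`splittingConst_eq_mul_prod_of_subset`, `IdeleUnitBoxSplittingConstants`),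
* the product formula `Λ₀(j(e_S)) = Λ₀(j(e_{S'})) ∏_{v ∈ S' ∖ S} λ_v(x₀_v)` for the finite Whittaker
  functional along Flath's factorisation (a clause of `exists_finWhittaker_prod_formula`),
* the unramified local evaluation `Ψ_v(s) = ∫_{K_vˣ} λ_v(ρ_v(diag(y,1)) x₀_v) |y|_v^s dμ_v = μ_v(𝒪_vˣ) λ_v(x₀_v) L_v(s)`
  at the good places (hypothesis `hunr`; Jacquet–Langlands (1970), Prop. 3.5 / the tree's
  `rsZeta_spherical_glOneRep_eq`), and
* the exhaustion `𝕀_K = ⋃_{S'} B(S'ᶜ)` (`tendsto_setIntegral_ideleUnitBox_compl`, `IdeleUnitBoxExhaustion`)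

into the Euler factorisation of the integral over ALL of `𝕀_K`:

* `tendsto_union_map_subtype_atTop` — the finite sets `S ∪ T`, `T ⊆ {v ∉ S}` finite, are cofinal;
* `setIntegral_ideleUnitBox_union_heckeIntegrand_pureTensor_eq` — for every finite `T ⊆ {v ∉ S}`,

    `∫_{B((S ∪ T)ᶜ)} W_φ(diag(a,1)) |a|^s dν(a) = c_S · Λ₀(j(e_S)) · Ψ_∞(s) · (∏_{v ∈ S} Ψ_v(s)) · ∏_{v ∈ T} L_v(s)`

  (the volumes `μ_v(𝒪_vˣ)` and the values `λ_v(x₀_v)` of the added places cancel EXACTLY against the change of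
  the splitting constant and of `Λ₀(j(e_·))` — no normalisation of measures or of spherical vectors is needed);
* `integral_heckeIntegrand_pureTensor_eq_mul_tprod` (**main**) — hence, if the Hecke integrand is integrable on
  `𝕀_K` and the good local factors have the product `L^S(s) = ∏_{v ∉ S} L_v(s)` (a `HasProd`),

    `∫_{𝕀_K} W_φ(diag(a,1)) |a|^s dν(a) = c_S · Λ₀(j(e_S)) · Ψ_∞(s) · (∏_{v ∈ S} Ψ_v(s)) · L^S(s)`,

  with `Ψ_∞(s) = ∫_{K_∞ˣ} ξ(u) N(u)^s dμ_∞` the archimedean Hecke integral of the Kirillov function `ξ` of `e`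
  and `Ψ_v(s) = ∫_{K_vˣ} λ_v(ρ_v(diag(y,1)) t_v) |y|_v^s dμ_v` the HONEST local Hecke integrals at `v ∈ S`
  (apply with `s - 1/2`). This is (11.1.2) of Jacquet–Langlands (1970) for the pure tensor
  `φ = e ⊗ (⊗_{v ∈ S} t_v) ⊗ (⊗_{v ∉ S} x₀_v)`, p. 171: "`Ψ(s, φ) = ∏_v Ψ(s, W_v)` … and for `v ∉ S`,
  `Ψ(s, W_v) = L(s, π_v)`"; Cogdell (2004), Thm. 2.2 with Thm. 3.3 for `(n, m) = (2, 1)`.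

## References

* H. Jacquet, R. P. Langlands, *Automorphic Forms on GL(2)*, LNM 114 (1970), §11, (11.1.2), p. 171, and
  Prop. 3.5 [JacquetLanglands1970].
* J. W. Cogdell, *Lectures on L-functions, converse theorems, and functoriality for GL_n* (2004), §2.3
  Thm. 2.2, §3 Thm. 3.3 [CogdellAnalyticTheory2004].
* J. Tate, *Fourier analysis in number fields and Hecke's zeta-functions* (1967), §4.3–§4.4
  [CasselsFrohlichANT1967].
-/

noncomputable section

open MeasureTheory Measure NumberField NumberField.mixedEmbedding IsDedekindDomain Set Filter Topology
open Literature.NumberTheory.GaloisRepresentations (ideleGroup unitIdeles localUnits)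
open Literature.NumberTheory.GaloisRepresentations.IsNonarchimedeanLocalField (normAbs)
open scoped MatrixGroups InnerProductSpace Classical NNReal ENNReal

namespace Literature.NumberTheory.Automorphic

variable {K : Type} [Field K] [NumberField K]

/-! ### 1. Cofinality of `T ↦ S ∪ T` -/

section Cofinal

omit [NumberField K] in
/-- The finite sets `S ∪ T`, `T` a finite set of places outside `S`, are cofinal among all finite sets of
finite places. [folklore] -/
theorem tendsto_union_map_subtype_atTop (S : Finset (HeightOneSpectrum (𝓞 K))) :
    Tendsto (fun T : Finset {v : HeightOneSpectrum (𝓞 K) // v ∉ S} =>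
      S ∪ T.map (Function.Embedding.subtype fun v => v ∉ S)) atTop atTop := by
  refine Filter.tendsto_atTop_atTop.2 fun S'' => ⟨S''.subtype fun v => v ∉ S, fun T hT v hv => ?_⟩
  by_cases hvS : v ∈ S
  · exact Finset.mem_union_left _ hvS
  · refine Finset.mem_union_right _ (Finset.mem_map.2 ⟨⟨v, hvS⟩, hT ?_, rfl⟩)
    exact Finset.mem_subtype.2 hv

omit [NumberField K] in
/-- `S` and `T ⊆ {v ∉ S}` are disjoint. [folklore] -/
theorem disjoint_map_subtype (S : Finset (HeightOneSpectrum (𝓞 K)))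
    (T : Finset {v : HeightOneSpectrum (𝓞 K) // v ∉ S}) :
    Disjoint S (T.map (Function.Embedding.subtype fun v => v ∉ S)) := by
  refine Finset.disjoint_left.2 fun v hvS hvT => ?_
  obtain ⟨t, -, rfl⟩ := Finset.mem_map.1 hvT
  exact t.2 hvS

omit [NumberField K] in
/-- Membership in `S ∪ T`. [folklore] -/
theorem not_mem_union_map_subtype_iff (S : Finset (HeightOneSpectrum (𝓞 K)))
    (T : Finset {v : HeightOneSpectrum (𝓞 K) // v ∉ S}) (v : HeightOneSpectrum (𝓞 K)) :
    v ∉ S ∪ T.map (Function.Embedding.subtype fun v => v ∉ S) ↔ ∃ hv : v ∉ S, (⟨v, hv⟩ : {v // v ∉ S}) ∉ T := by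
  constructor
  · intro h
    have hvS : v ∉ S := fun h' => h (Finset.mem_union_left _ h')
    refine ⟨hvS, fun hT => h (Finset.mem_union_right _ (Finset.mem_map.2 ⟨⟨v, hvS⟩, hT, rfl⟩))⟩
  · rintro ⟨hvS, hT⟩ h
    rcases Finset.mem_union.1 h with h | h
    · exact hvS h
    · obtain ⟨t, ht, hte⟩ := Finset.mem_map.1 h
      have : t = ⟨v, hvS⟩ := Subtype.ext hte
      exact hT (this ▸ ht)

end Cofinal

/-! ### 2. The Euler factorisation -/

section Euler

variable {μ : Measure (AdelicGroupData.gl 2 K).automorphicQuotient}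
  [(AdelicGroupData.gl 2 K).IsAutomorphicMeasure μ]

-- the house Borel structures on `GL₂(𝔸_K)` (as in `PureTensorCuspForm`)
attribute [local instance] adelicBorel borelSpace_adelic locallyCompactSpace_adelic
  secondCountableTopology_gl_adelic glAdeleBorel borelSpace_glAdele

set_option backward.isDefEq.respectTransparency false

variable {hcpt : isCompact_glFiniteIntegralLevel 2 K}
  {E : Type*} [NormedAddCommGroup E] [InnerProductSpace ℂ E] [CompleteSpace E]
  {τ : ContRepresentation ℂ (AutomorphyDatum.gl 2 K hcpt).arch.carrier E}
  {V : HeightOneSpectrum (𝓞 K) → Type*} [∀ v, AddCommGroup (V v)] [∀ v, Module ℂ (V v)]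

variable [MeasurableSpace (ideleGroup K)] [BorelSpace (ideleGroup K)]
  [MeasurableSpace ((mixedSpace K)ˣ)] [BorelSpace ((mixedSpace K)ˣ)]
  [∀ v : HeightOneSpectrum (𝓞 K), MeasurableSpace ((v.adicCompletion K)ˣ)]
  [∀ v : HeightOneSpectrum (𝓞 K), BorelSpace ((v.adicCompletion K)ˣ)]

/-- **The Hecke integral of a pure tensor over `B((S ∪ T)ᶜ)`, `T` a finite set of GOOD places.** With the
data of `HeckeIntegrandPureTensorOnBox` for the pure tensor `e ⊗ j(x)` (`x_v = x₀_v` and `x₀_v` spherical off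
`S`), the splitting constant `c` of `ν|_{B(Sᶜ)}` against `μ_∞ ⊗ ⊗_{v ∈ S} μ_v` (measure identity `hc`), the
product formula `hslot` / `hlam1` of `exists_finWhittaker_prod_formula`, and the unramified local
evaluations `∫ λ_v(ρ_v(diag(y,1)) x₀_v) |y|_v^s dμ_v = μ_v(𝒪_vˣ) λ_v(x₀_v) L_v` at the places of `T` (`hunr`):

  `∫_{B((S ∪ T)ᶜ)} W_φ(diag(a,1)) |a|^s dν = c · Λ₀(j(e_S)) · Ψ_∞(s) · (∏_{v ∈ S} Ψ_v(s)) · ∏_{v ∈ T} L_v`.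

The `S ∪ T`-box identity carries the constant `c_{S∪T}` and `Λ₀(j(e_{S∪T}))`; the factors `μ_v(𝒪_vˣ)` and
`λ_v(x₀_v)`, `v ∈ T`, of the local evaluations recombine with them into `c_S` and `Λ₀(j(e_S))`
(`splittingConst_eq_mul_prod_of_subset`). [cite: JacquetLanglands1970, §11 (11.1.2), p. 171]
[cite: CogdellAnalyticTheory2004, §2.3 Thm. 2.2] -/
theorem setIntegral_ideleUnitBox_union_heckeIntegrand_pureTensor_eq (P : CuspidalAutomorphicRepGL 2 K μ)
    (hτ : τ.IsStronglyContinuous) (ν₀ : Measure ↥(adelicUnipotent 2 K)) [IsHaarMeasure ν₀]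
    {T₀ : multiplicityModule hcpt τ P.1} {Λ₀ : multiplicityModule hcpt τ P.1 →ₗ[ℂ] ℂ}
    (hΛ : ∀ T : multiplicityModule hcpt τ P.1,
      transferMap (whittakerFunctional ν₀ (continuous_adeleAddChar K)
        (ContRepresentation.Equiv.refl P.1.toContRep)) hτ T =
        Λ₀ T • transferMap (whittakerFunctional ν₀ (continuous_adeleAddChar K)
          (ContRepresentation.Equiv.refl P.1.toContRep)) hτ T₀)
    {ρ : ∀ v : HeightOneSpectrum (𝓞 K), Representation ℂ (GL (Fin 2) (v.adicCompletion K)) (V v)}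
    {x₀ : ∀ v, V v} {j : RestrictedFamily V x₀ → multiplicityModule hcpt τ P.1}
    {lam : ∀ v, Module.Dual ℂ (V v)} {eu : ∀ v, V v}
    (hprod : ∀ (S : Finset (HeightOneSpectrum (𝓞 K))) (gf : GL (Fin 2) (FiniteAdeleRing (𝓞 K) K))
      (x : RestrictedFamily V x₀), (∀ v ∉ S, ρ v (GLn.restrictedPiEquiv 2 K gf v) (x v) = x₀ v) →
      Λ₀ (finComponentRep hcpt τ P.1 gf (j x)) =
        Λ₀ (j (RestrictedFamily.extend S fun v : S => eu v)) *
          ∏ v ∈ S, lam v (ρ v (GLn.restrictedPiEquiv 2 K gf v) (x v)))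
    (hslot : ∀ (S : Finset (HeightOneSpectrum (𝓞 K))) (x y : RestrictedFamily V x₀),
      (∀ v ∈ S, y v = eu v) → (∀ v ∉ S, y v = x v) → Λ₀ (j x) = Λ₀ (j y) * ∏ v ∈ S, lam v (x v))
    (hlam1 : ∀ v, lam v (eu v) = 1)
    (S : Finset (HeightOneSpectrum (𝓞 K))) (x : RestrictedFamily V x₀) (e : archGardingSpace hcpt τ)
    (hxS : ∀ v ∉ S, x v = x₀ v)
    (hfix : ∀ v ∉ S, x₀ v ∈ (ρ v).fixedPoints (glInt 2 (v.adicCompletion K)))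
    (ν : Measure (ideleGroup K)) [IsFiniteMeasureOnCompacts ν] [ν.IsMulLeftInvariant]
    (μinf : Measure (mixedSpace K)ˣ) [IsHaarMeasure μinf]
    (μv : ∀ v : HeightOneSpectrum (𝓞 K), Measure (v.adicCompletion K)ˣ) [∀ v, IsHaarMeasure (μv v)]
    {c : ℝ≥0}
    (hc : (ν.restrict (ideleUnitBox (K := K) {w | w ∉ S})).map
        (fun a : ideleGroup K => (archUnitsOfIdele K a,
          fun v : ↥S => (GaloisRepresentations.ideleGroup.finComp v.1).toHomUnits a)) =
      c • (μinf.prod (Measure.pi fun v : ↥S => μv v.1)))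
    (s : ℂ) (L : {v : HeightOneSpectrum (𝓞 K) // v ∉ S} → ℂ)
    (hunr : ∀ t : {v : HeightOneSpectrum (𝓞 K) // v ∉ S},
      Integrable (fun y : (t.1.adicCompletion K)ˣ => lam t.1 (ρ t.1 (diagGL2 y 1) (x₀ t.1)) *
        (((normAbs (t.1.adicCompletion K) (y : t.1.adicCompletion K) : ℝ≥0) : ℝ) : ℂ) ^ s) (μv t.1) ∧
      ∫ y : (t.1.adicCompletion K)ˣ, lam t.1 (ρ t.1 (diagGL2 y 1) (x₀ t.1)) *
          (((normAbs (t.1.adicCompletion K) (y : t.1.adicCompletion K) : ℝ≥0) : ℝ) : ℂ) ^ s ∂(μv t.1) =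
        ((μv t.1 {y : (t.1.adicCompletion K)ˣ | Valued.v (y : t.1.adicCompletion K) = 1}).toReal : ℂ) *
          lam t.1 (x₀ t.1) * L t)
    (hgi : Integrable (fun u : (mixedSpace K)ˣ =>
      kirillovFn hτ (transferMap (whittakerFunctional ν₀ (continuous_adeleAddChar K)
          (ContRepresentation.Equiv.refl P.1.toContRep)) hτ T₀) e u *
        ((mixedEmbedding.norm ((u : (mixedSpace K)ˣ) : mixedSpace K) : ℝ) : ℂ) ^ s) μinf)
    (hhi : ∀ v ∈ S, Integrable (fun y : (v.adicCompletion K)ˣ =>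
      lam v (ρ v (diagGL2 y 1) (x v)) *
        (((normAbs (v.adicCompletion K) (y : v.adicCompletion K) : ℝ≥0) : ℝ) : ℂ) ^ s) (μv v))
    (T : Finset {v : HeightOneSpectrum (𝓞 K) // v ∉ S}) :
    ∫ a in ideleUnitBox (K := K) {w | w ∉ S ∪ T.map (Function.Embedding.subtype fun v => v ∉ S)},
        whittakerDepth 0 (invQuot (AdelicGroupData.gl 2 K)
          (contRep (((j x : multiplicityModule hcpt τ P.1) : E →L[ℂ] (AdelicGroupData.gl 2 K).L2 μ) (e : E))))
          (glDiagonal 2 (AdeleRing (𝓞 K) K) ![a, 1]) *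
        ((IdeleClassGroup.ideleNorm K a : ℝ) : ℂ) ^ s ∂ν =
      (c : ℂ) * Λ₀ (j (RestrictedFamily.extend S fun v : S => eu v)) *
        (∫ u : (mixedSpace K)ˣ, kirillovFn hτ (transferMap (whittakerFunctional ν₀ (continuous_adeleAddChar K)
            (ContRepresentation.Equiv.refl P.1.toContRep)) hτ T₀) e u *
          ((mixedEmbedding.norm ((u : (mixedSpace K)ˣ) : mixedSpace K) : ℝ) : ℂ) ^ s ∂μinf) *
        (∏ v ∈ S, ∫ y : (v.adicCompletion K)ˣ, lam v (ρ v (diagGL2 y 1) (x v)) *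
          (((normAbs (v.adicCompletion K) (y : v.adicCompletion K) : ℝ≥0) : ℝ) : ℂ) ^ s ∂(μv v)) *
        ∏ t ∈ T, L t := by
  set emb : {v : HeightOneSpectrum (𝓞 K) // v ∉ S} ↪ HeightOneSpectrum (𝓞 K) :=
    Function.Embedding.subtype fun v => v ∉ S with hemb
  set S' : Finset (HeightOneSpectrum (𝓞 K)) := S ∪ T.map emb with hS'
  have hSS' : S ⊆ S' := Finset.subset_union_left
  have hdisj : Disjoint S (T.map emb) := disjoint_map_subtype S T
  have hsdiff : S' \ S = T.map emb := Finset.union_sdiff_cancel_left hdisj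
  -- the unit groups and their (finite) volumes
  set U : ∀ v : HeightOneSpectrum (𝓞 K), Set (v.adicCompletion K)ˣ := fun v =>
    {y : (v.adicCompletion K)ˣ | Valued.v (y : v.adicCompletion K) = 1} with hU
  have hUt : ∀ v, μv v (U v) ≠ ∞ := fun v => measure_units_valued_eq_one_ne_top v (μv v)
  -- data for the box `B(S'ᶜ)`
  have hxS' : ∀ v ∉ S', x v = x₀ v := fun v hv => hxS v fun h => hv (hSS' h)
  have hfix' : ∀ v ∉ S', x₀ v ∈ (ρ v).fixedPoints (glInt 2 (v.adicCompletion K)) :=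
    fun v hv => hfix v fun h => hv (hSS' h)
  obtain ⟨c', hc', hsplit'⟩ := exists_splittingConst_ideleUnitBox_compl ν μinf μv S'
  have hhi' : ∀ v ∈ S', Integrable (fun y : (v.adicCompletion K)ˣ =>
      lam v (ρ v (diagGL2 y 1) (x v)) *
        (((normAbs (v.adicCompletion K) (y : v.adicCompletion K) : ℝ≥0) : ℝ) : ℂ) ^ s) (μv v) := by
    intro v hv
    rcases Finset.mem_union.1 hv with hvS | hvT
    · exact hhi v hvS
    · obtain ⟨t, -, rfl⟩ := Finset.mem_map.1 hvT
      have h := (hunr t).1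
      rw [← hxS t.1 t.2] at h
      exact h
  -- the `S'`-box identity
  obtain ⟨-, hbox⟩ := setIntegral_ideleUnitBox_heckeIntegrand_pureTensor P hτ ν₀ hΛ hprod S' x e hxS' hfix'
    ν μinf μv hsplit' s hgi hhi'
  rw [hbox]
  -- split the product over `S' = S ⊔ T`
  rw [Finset.prod_union hdisj, Finset.prod_map]
  have hT : ∀ t ∈ T, ∫ y : ((emb t).adicCompletion K)ˣ, lam (emb t) (ρ (emb t) (diagGL2 y 1) (x (emb t))) *
      (((normAbs ((emb t).adicCompletion K) (y : (emb t).adicCompletion K) : ℝ≥0) : ℝ) : ℂ) ^ s ∂(μv (emb t)) =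
      ((μv t.1 (U t.1)).toReal : ℂ) * lam t.1 (x₀ t.1) * L t := by
    intro t _
    change ∫ y : (t.1.adicCompletion K)ˣ, lam t.1 (ρ t.1 (diagGL2 y 1) (x t.1)) *
      (((normAbs (t.1.adicCompletion K) (y : t.1.adicCompletion K) : ℝ≥0) : ℝ) : ℂ) ^ s ∂(μv t.1) = _
    rw [hxS t.1 t.2]
    exact (hunr t).2
  rw [Finset.prod_congr rfl hT, Finset.prod_mul_distrib, Finset.prod_mul_distrib]
  -- the constants: `c = c' ∏_{t ∈ T} μ_t(𝒪ˣ)`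
  have hcc' : (c : ℂ) = (c' : ℂ) * ∏ t ∈ T, ((μv t.1 (U t.1)).toReal : ℂ) := by
    have h := splittingConst_eq_mul_prod_of_subset ν μinf μv hSS' hc hc'
    rw [hsdiff, Finset.prod_map] at h
    have h' := congrArg ENNReal.toReal h
    rw [ENNReal.coe_toReal, ENNReal.toReal_mul, ENNReal.coe_toReal, ENNReal.toReal_prod] at h'
    have h'' := congrArg (fun r : ℝ => (r : ℂ)) h'
    simp only [Complex.ofReal_mul, Complex.ofReal_prod] at h''
    exact h''
  -- the finite Whittaker functional: `Λ₀(j(e_S)) = Λ₀(j(e_{S'})) ∏_{t ∈ T} λ_t(x₀_t)`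
  have hΛS : Λ₀ (j (RestrictedFamily.extend S fun v : S => eu v)) =
      Λ₀ (j (RestrictedFamily.extend S' fun v : S' => eu v)) * ∏ t ∈ T, lam t.1 (x₀ t.1) := by
    have h := hslot S' (RestrictedFamily.extend S fun v : S => eu v) (RestrictedFamily.extend S' fun v : S' => eu v)
      (fun v hv => RestrictedFamily.extend_apply_of_mem S' _ hv)
      (fun v hv => by
        rw [RestrictedFamily.extend_apply_of_notMem S' _ hv,
          RestrictedFamily.extend_apply_of_notMem S _ (fun h => hv (hSS' h))])
    rw [h, Finset.prod_union hdisj, Finset.prod_map]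
    have h1 : ∏ v ∈ S, lam v ((RestrictedFamily.extend (x₀ := x₀) S fun v : S => eu v) v) = 1 :=
      Finset.prod_eq_one fun v hv => by rw [RestrictedFamily.extend_apply_of_mem (x₀ := x₀) S _ hv, hlam1]
    have h2 : ∏ t ∈ T, lam (emb t) ((RestrictedFamily.extend (x₀ := x₀) S fun v : S => eu v) (emb t)) =
        ∏ t ∈ T, lam t.1 (x₀ t.1) :=
      Finset.prod_congr rfl fun t _ => by
        change lam t.1 ((RestrictedFamily.extend (x₀ := x₀) S fun v : S => eu v) t.1) = _
        rw [RestrictedFamily.extend_apply_of_notMem (x₀ := x₀) S _ t.2]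
    rw [h1, h2, one_mul]
  rw [hcc', hΛS]
  ring

/-- **MAIN. The Euler factorisation of the unfolded global Hecke integral of a pure tensor cusp form of `GL₂`**
(Jacquet–Langlands (1970), (11.1.2)). With the data above, suppose the Hecke integrand
`a ↦ W_φ(diag(a,1)) |a|^s` is integrable on `𝕀_K` and the good local factors `L_v`, `v ∉ S`, have the product
`L^S` (as a `HasProd` over the finite subsets of `{v ∉ S}`). Then

  `∫_{𝕀_K} W_φ(diag(a,1)) |a|^s dν(a) = c · Λ₀(j(e_S)) · Ψ_∞(s) · (∏_{v ∈ S} Ψ_v(s)) · L^S`,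

`Ψ_∞(s) = ∫ ξ(u) N(u)^s dμ_∞` (`ξ = kirillovFn ℓ_∞ e`), `Ψ_v(s) = ∫ λ_v(ρ_v(diag(y,1)) x_v) |y|_v^s dμ_v` the honest
local Hecke integrals at `v ∈ S`: both sides are the limit along `T ↑ {v ∉ S}` of the integrals over the boxes
`B((S ∪ T)ᶜ)` (`setIntegral_ideleUnitBox_union_heckeIntegrand_pureTensor_eq`,
`tendsto_setIntegral_ideleUnitBox_compl`). [cite: JacquetLanglands1970, §11 (11.1.2), p. 171]
[cite: CogdellAnalyticTheory2004, §2.3 Thm. 2.2] -/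
theorem integral_heckeIntegrand_pureTensor_eq_mul_tprod (P : CuspidalAutomorphicRepGL 2 K μ)
    (hτ : τ.IsStronglyContinuous) (ν₀ : Measure ↥(adelicUnipotent 2 K)) [IsHaarMeasure ν₀]
    {T₀ : multiplicityModule hcpt τ P.1} {Λ₀ : multiplicityModule hcpt τ P.1 →ₗ[ℂ] ℂ}
    (hΛ : ∀ T : multiplicityModule hcpt τ P.1,
      transferMap (whittakerFunctional ν₀ (continuous_adeleAddChar K)
        (ContRepresentation.Equiv.refl P.1.toContRep)) hτ T =
        Λ₀ T • transferMap (whittakerFunctional ν₀ (continuous_adeleAddChar K)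
          (ContRepresentation.Equiv.refl P.1.toContRep)) hτ T₀)
    {ρ : ∀ v : HeightOneSpectrum (𝓞 K), Representation ℂ (GL (Fin 2) (v.adicCompletion K)) (V v)}
    {x₀ : ∀ v, V v} {j : RestrictedFamily V x₀ → multiplicityModule hcpt τ P.1}
    {lam : ∀ v, Module.Dual ℂ (V v)} {eu : ∀ v, V v}
    (hprod : ∀ (S : Finset (HeightOneSpectrum (𝓞 K))) (gf : GL (Fin 2) (FiniteAdeleRing (𝓞 K) K))
      (x : RestrictedFamily V x₀), (∀ v ∉ S, ρ v (GLn.restrictedPiEquiv 2 K gf v) (x v) = x₀ v) →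
      Λ₀ (finComponentRep hcpt τ P.1 gf (j x)) =
        Λ₀ (j (RestrictedFamily.extend S fun v : S => eu v)) *
          ∏ v ∈ S, lam v (ρ v (GLn.restrictedPiEquiv 2 K gf v) (x v)))
    (hslot : ∀ (S : Finset (HeightOneSpectrum (𝓞 K))) (x y : RestrictedFamily V x₀),
      (∀ v ∈ S, y v = eu v) → (∀ v ∉ S, y v = x v) → Λ₀ (j x) = Λ₀ (j y) * ∏ v ∈ S, lam v (x v))
    (hlam1 : ∀ v, lam v (eu v) = 1)
    (S : Finset (HeightOneSpectrum (𝓞 K))) (x : RestrictedFamily V x₀) (e : archGardingSpace hcpt τ)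
    (hxS : ∀ v ∉ S, x v = x₀ v)
    (hfix : ∀ v ∉ S, x₀ v ∈ (ρ v).fixedPoints (glInt 2 (v.adicCompletion K)))
    (ν : Measure (ideleGroup K)) [IsFiniteMeasureOnCompacts ν] [ν.IsMulLeftInvariant]
    (μinf : Measure (mixedSpace K)ˣ) [IsHaarMeasure μinf]
    (μv : ∀ v : HeightOneSpectrum (𝓞 K), Measure (v.adicCompletion K)ˣ) [∀ v, IsHaarMeasure (μv v)]
    {c : ℝ≥0}
    (hc : (ν.restrict (ideleUnitBox (K := K) {w | w ∉ S})).map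
        (fun a : ideleGroup K => (archUnitsOfIdele K a,
          fun v : ↥S => (GaloisRepresentations.ideleGroup.finComp v.1).toHomUnits a)) =
      c • (μinf.prod (Measure.pi fun v : ↥S => μv v.1)))
    (s : ℂ) (L : {v : HeightOneSpectrum (𝓞 K) // v ∉ S} → ℂ) {Lprod : ℂ} (hL : HasProd L Lprod)
    (hunr : ∀ t : {v : HeightOneSpectrum (𝓞 K) // v ∉ S},
      Integrable (fun y : (t.1.adicCompletion K)ˣ => lam t.1 (ρ t.1 (diagGL2 y 1) (x₀ t.1)) *
        (((normAbs (t.1.adicCompletion K) (y : t.1.adicCompletion K) : ℝ≥0) : ℝ) : ℂ) ^ s) (μv t.1) ∧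
      ∫ y : (t.1.adicCompletion K)ˣ, lam t.1 (ρ t.1 (diagGL2 y 1) (x₀ t.1)) *
          (((normAbs (t.1.adicCompletion K) (y : t.1.adicCompletion K) : ℝ≥0) : ℝ) : ℂ) ^ s ∂(μv t.1) =
        ((μv t.1 {y : (t.1.adicCompletion K)ˣ | Valued.v (y : t.1.adicCompletion K) = 1}).toReal : ℂ) *
          lam t.1 (x₀ t.1) * L t)
    (hgi : Integrable (fun u : (mixedSpace K)ˣ =>
      kirillovFn hτ (transferMap (whittakerFunctional ν₀ (continuous_adeleAddChar K)
          (ContRepresentation.Equiv.refl P.1.toContRep)) hτ T₀) e u *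
        ((mixedEmbedding.norm ((u : (mixedSpace K)ˣ) : mixedSpace K) : ℝ) : ℂ) ^ s) μinf)
    (hhi : ∀ v ∈ S, Integrable (fun y : (v.adicCompletion K)ˣ =>
      lam v (ρ v (diagGL2 y 1) (x v)) *
        (((normAbs (v.adicCompletion K) (y : v.adicCompletion K) : ℝ≥0) : ℝ) : ℂ) ^ s) (μv v))
    (hint : Integrable (fun a : ideleGroup K =>
      whittakerDepth 0 (invQuot (AdelicGroupData.gl 2 K)
        (contRep (((j x : multiplicityModule hcpt τ P.1) : E →L[ℂ] (AdelicGroupData.gl 2 K).L2 μ) (e : E))))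
        (glDiagonal 2 (AdeleRing (𝓞 K) K) ![a, 1]) *
      ((IdeleClassGroup.ideleNorm K a : ℝ) : ℂ) ^ s) ν) :
    ∫ a, whittakerDepth 0 (invQuot (AdelicGroupData.gl 2 K)
          (contRep (((j x : multiplicityModule hcpt τ P.1) : E →L[ℂ] (AdelicGroupData.gl 2 K).L2 μ) (e : E))))
          (glDiagonal 2 (AdeleRing (𝓞 K) K) ![a, 1]) *
        ((IdeleClassGroup.ideleNorm K a : ℝ) : ℂ) ^ s ∂ν =
      (c : ℂ) * Λ₀ (j (RestrictedFamily.extend S fun v : S => eu v)) *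
        (∫ u : (mixedSpace K)ˣ, kirillovFn hτ (transferMap (whittakerFunctional ν₀ (continuous_adeleAddChar K)
            (ContRepresentation.Equiv.refl P.1.toContRep)) hτ T₀) e u *
          ((mixedEmbedding.norm ((u : (mixedSpace K)ˣ) : mixedSpace K) : ℝ) : ℂ) ^ s ∂μinf) *
        (∏ v ∈ S, ∫ y : (v.adicCompletion K)ˣ, lam v (ρ v (diagGL2 y 1) (x v)) *
          (((normAbs (v.adicCompletion K) (y : v.adicCompletion K) : ℝ≥0) : ℝ) : ℂ) ^ s ∂(μv v)) *
        Lprod := by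
  -- the integrals over the boxes `B((S ∪ T)ᶜ)` tend to the integral over `𝕀_K` …
  have h1 : Tendsto (fun T : Finset {v : HeightOneSpectrum (𝓞 K) // v ∉ S} =>
      ∫ a in ideleUnitBox (K := K) {w | w ∉ S ∪ T.map (Function.Embedding.subtype fun v => v ∉ S)},
        whittakerDepth 0 (invQuot (AdelicGroupData.gl 2 K)
          (contRep (((j x : multiplicityModule hcpt τ P.1) : E →L[ℂ] (AdelicGroupData.gl 2 K).L2 μ) (e : E))))
          (glDiagonal 2 (AdeleRing (𝓞 K) K) ![a, 1]) *
        ((IdeleClassGroup.ideleNorm K a : ℝ) : ℂ) ^ s ∂ν) atTop (𝓝 (∫ a,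
      whittakerDepth 0 (invQuot (AdelicGroupData.gl 2 K)
          (contRep (((j x : multiplicityModule hcpt τ P.1) : E →L[ℂ] (AdelicGroupData.gl 2 K).L2 μ) (e : E))))
          (glDiagonal 2 (AdeleRing (𝓞 K) K) ![a, 1]) *
        ((IdeleClassGroup.ideleNorm K a : ℝ) : ℂ) ^ s ∂ν)) :=
    (tendsto_setIntegral_ideleUnitBox_compl ν hint).comp (tendsto_union_map_subtype_atTop S)
  -- … and are the partial Euler products
  have h2 : Tendsto (fun T : Finset {v : HeightOneSpectrum (𝓞 K) // v ∉ S} =>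
      (c : ℂ) * Λ₀ (j (RestrictedFamily.extend S fun v : S => eu v)) *
        (∫ u : (mixedSpace K)ˣ, kirillovFn hτ (transferMap (whittakerFunctional ν₀ (continuous_adeleAddChar K)
            (ContRepresentation.Equiv.refl P.1.toContRep)) hτ T₀) e u *
          ((mixedEmbedding.norm ((u : (mixedSpace K)ˣ) : mixedSpace K) : ℝ) : ℂ) ^ s ∂μinf) *
        (∏ v ∈ S, ∫ y : (v.adicCompletion K)ˣ, lam v (ρ v (diagGL2 y 1) (x v)) *
          (((normAbs (v.adicCompletion K) (y : v.adicCompletion K) : ℝ≥0) : ℝ) : ℂ) ^ s ∂(μv v)) *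
        ∏ t ∈ T, L t) atTop (𝓝 ((c : ℂ) * Λ₀ (j (RestrictedFamily.extend S fun v : S => eu v)) *
        (∫ u : (mixedSpace K)ˣ, kirillovFn hτ (transferMap (whittakerFunctional ν₀ (continuous_adeleAddChar K)
            (ContRepresentation.Equiv.refl P.1.toContRep)) hτ T₀) e u *
          ((mixedEmbedding.norm ((u : (mixedSpace K)ˣ) : mixedSpace K) : ℝ) : ℂ) ^ s ∂μinf) *
        (∏ v ∈ S, ∫ y : (v.adicCompletion K)ˣ, lam v (ρ v (diagGL2 y 1) (x v)) *
          (((normAbs (v.adicCompletion K) (y : v.adicCompletion K) : ℝ≥0) : ℝ) : ℂ) ^ s ∂(μv v)) *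
        Lprod)) :=
    hL.const_mul _
  have heq : (fun T : Finset {v : HeightOneSpectrum (𝓞 K) // v ∉ S} =>
      ∫ a in ideleUnitBox (K := K) {w | w ∉ S ∪ T.map (Function.Embedding.subtype fun v => v ∉ S)},
        whittakerDepth 0 (invQuot (AdelicGroupData.gl 2 K)
          (contRep (((j x : multiplicityModule hcpt τ P.1) : E →L[ℂ] (AdelicGroupData.gl 2 K).L2 μ) (e : E))))
          (glDiagonal 2 (AdeleRing (𝓞 K) K) ![a, 1]) *
        ((IdeleClassGroup.ideleNorm K a : ℝ) : ℂ) ^ s ∂ν) =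
      fun T => (c : ℂ) * Λ₀ (j (RestrictedFamily.extend S fun v : S => eu v)) *
        (∫ u : (mixedSpace K)ˣ, kirillovFn hτ (transferMap (whittakerFunctional ν₀ (continuous_adeleAddChar K)
            (ContRepresentation.Equiv.refl P.1.toContRep)) hτ T₀) e u *
          ((mixedEmbedding.norm ((u : (mixedSpace K)ˣ) : mixedSpace K) : ℝ) : ℂ) ^ s ∂μinf) *
        (∏ v ∈ S, ∫ y : (v.adicCompletion K)ˣ, lam v (ρ v (diagGL2 y 1) (x v)) *
          (((normAbs (v.adicCompletion K) (y : v.adicCompletion K) : ℝ≥0) : ℝ) : ℂ) ^ s ∂(μv v)) *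
        ∏ t ∈ T, L t :=
    funext fun T => setIntegral_ideleUnitBox_union_heckeIntegrand_pureTensor_eq P hτ ν₀ hΛ hprod hslot hlam1
      S x e hxS hfix ν μinf μv hc s L hunr hgi hhi T
  rw [heq] at h1
  exact tendsto_nhds_unique h1 h2

end Euler

end Literature.NumberTheory.Automorphic
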